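import Literature.Geometry.Riemannian.GradientSolitonIdentities
import Literature.Geometry.Riemannian.ShrinkerEigenvalueAlgebra
import Literature.Geometry.Lorentzian.CoordPinchingMinimum
import Literature.Geometry.Lorentzian.CoordRicciEigenframe
import HarnessLib

/-!
# The eigenvalues of `Ric` at the minimum of `λ_min(Ric)/R` on a three-dimensional shrinker

Assembly of the point computation of Eminenti–La Nave–Mantegazza 2008, §3 (p. 7), in the
coordinate language (`MetricCoord`): on a gradient Ricci soliton `Ric + Hess f = λG` on an open set
`V` of a `3`-dimensional model space, at a point `x ∈ V` with `S(x) > 0` where the pinching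
`Ric_y(w,w) ≥ m S(y) G_y(w,w)` (all `y ∈ V`, `w`) is attained on a `G_x`-unit eigenvector `e₀` of an
orthonormal eigenframe `(e₀,e₁,e₂)` of `Ric_x` with ordered eigenvalues `μ₀ ≤ μ₁ ≤ μ₂`:

* the second-order condition `m ΔS ≤ (ΔRic)(e₀,e₀)` and the first-order identities
  `(∇_X Ric)(e₀,e₀) = m dS(X)` (`CoordPinchingMinimum.pinching_minimum_laplacian`), Hamilton's
  identities `ΔS = dS(∇f) + 2λS − 2|Ric|²` (`GradientSolitonIdentities`) and
  `(ΔRic)(e₀,e₀) = (∇_{∇f}Ric)(e₀,e₀) + 2λμ₀ − μ₁(μ₀+μ₁−μ₂) − μ₂(μ₀+μ₂−μ₁)`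
  (`CoordRicciEigenframe`) combine — the `∇f`-terms cancel by the first-order identity in the
  direction `∇f` — to `μ₁(μ₀+μ₁−μ₂) + μ₂(μ₀+μ₂−μ₁) ≤ 2m|Ric|²`
  (`IsMetricOn.eigenframe_ineq_at_pinching_minimum`), which after multiplication by `S > 0`
  (`μ₀ = mS`) is exactly ELM's `0 ≤ R³ − 3λR² + 4λ²R − 2SR + 2λS` (`ShrinkerEigenvalueAlgebra`);
* **`IsMetricOn.eigenvalues_at_pinching_minimum_three`** — hence
  `(μ₀ = 0 ∧ μ₁ = μ₂) ∨ (μ₀ = μ₁ = μ₂)` (ELM: "either `λ_min(p) = 0` and all the other `n − 1`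
  eigenvalues of the Ricci tensor are equal, or all the eigenvalues are equal").

Everything is proved; no definitions are introduced.

## References

* M. Eminenti, G. La Nave, C. Mantegazza, *Ricci solitons: the equation point of view*,
  manuscripta math. 127 (2008), §3 (p. 7). [EminentiLanaveMantegazza2008]
* O. Munteanu, J. Wang, *Structure at infinity for shrinking Ricci solitons*, arXiv:1606.01861,
  §2 (p. 6) (the identities for `S` and `Ric`). [MunteanuWang2016]
-/

noncomputable section

set_option maxSynthPendingDepth 3

open Set Filter Module
open scoped Topology ContDiff

namespace Literature.Geometry.Lorentzian

namespace MetricCoord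

variable {E : Type*} [NormedAddCommGroup E] [NormedSpace ℝ E] [FiniteDimensional ℝ E]
  [CompleteSpace E] {G : E → E →L[ℝ] E →L[ℝ] ℝ} {V : Set E} {x : E} {f : E → ℝ} {lam m : ℝ}

/-- **The eigenframe inequality at a pinching minimum** (ELM 2008, §3, p. 7, the display
`0 ≤ Δ(R_{ij}/R)(p)vⁱvʲ = …` in dimension three, in the form
`μ₁(μ₀+μ₁−μ₂) + μ₂(μ₀+μ₂−μ₁) ≤ 2m|Ric|²`, `m = μ₀/S` the pinching constant).
[cite: EminentiLanaveMantegazza2008, §3 (p. 7)]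
[cite: MunteanuWang2016, §2 (p. 6)] -/
theorem IsMetricOn.eigenframe_ineq_at_pinching_minimum (hG : IsMetricOn G V) (hx : x ∈ V)
    (hpos : ∀ w : E, w ≠ 0 → 0 < G x w w) (hf : ContDiffOn ℝ ∞ f V)
    (hsol : ∀ y ∈ V, ∀ v w, ricAt G y v w + hessAt G f y v w = lam * G y v w)
    (e : Basis (Fin 3) ℝ E) (he : ∀ i j, G x (e i) (e j) = if i = j then 1 else 0)
    {μ : Fin 3 → ℝ} (hμ : ∀ i w, ricAt G x (e i) w = μ i * G x (e i) w)
    (hmin : ∀ y ∈ V, ∀ w, m * scalAt G y * G y w w ≤ ricAt G y w w)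
    (heq : ricAt G x (e 0) (e 0) = m * scalAt G x * G x (e 0) (e 0)) :
    μ 1 * (μ 0 + μ 1 - μ 2) + μ 2 * (μ 0 + μ 2 - μ 1) ≤ 2 * m * (μ 0 ^ 2 + μ 1 ^ 2 + μ 2 ^ 2) := by
  have he00 : G x (e 0) (e 0) = 1 := by rw [he]; simp
  have hμ0 : μ 0 = m * scalAt G x := by
    have h := heq
    rw [hμ, he00] at h
    linarith
  -- the minimum-point conditions
  obtain ⟨hfirst, hsecond⟩ := hG.pinching_minimum_laplacian hx hpos hG.contDiffOn_ricAt
    hG.contDiffOn_scalAt hmin heq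
  -- Hamilton's identities at `x`
  have hlapS := hG.lapAt_scalAt_of_soliton hx hf hsol
  have hlapR := hG.lapBilinAt_ricAt_self_of_soliton_eigenframe e he hμ hx hf hsol
  have hnorm := hG.normSqAt_ricAt_eq_sum_of_eigenframe e he hμ hx
  have hX := hfirst (sharpAt G x (fderiv ℝ f x))
  rw [he00, mul_one] at hX hsecond
  rw [hlapS, hnorm, Fin.sum_univ_three] at hsecond
  -- `m ΔS ≤ ΔRic(e₀,e₀)`: the `∇f` terms cancel
  set A := fderiv ℝ (scalAt G) x (sharpAt G x (fderiv ℝ f x)) with hA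
  have h1 : m * A + 2 * lam * (m * scalAt G x) - 2 * m * (μ 0 ^ 2 + μ 1 ^ 2 + μ 2 ^ 2) ≤
      lapBilinAt G (ricAt G) x (e 0) (e 0) := by
    have : m * (A + 2 * lam * scalAt G x - 2 * (μ 0 ^ 2 + μ 1 ^ 2 + μ 2 ^ 2)) =
        m * A + 2 * lam * (m * scalAt G x) - 2 * m * (μ 0 ^ 2 + μ 1 ^ 2 + μ 2 ^ 2) := by ring
    rw [← this]
    exact hsecond
  rw [hX] at hlapR
  rw [← hμ0] at h1
  linarith

/-- **The eigenvalues of `Ric` at the minimum of `λ_min(Ric)/R` on a three-dimensional gradient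
shrinking soliton** (Eminenti–La Nave–Mantegazza 2008, §3, p. 7): with the notation of
`eigenframe_ineq_at_pinching_minimum`, if moreover `μ₀ ≤ μ₁ ≤ μ₂` and `S(x) > 0` then either
`μ₀ = 0` and `μ₁ = μ₂`, or `μ₀ = μ₁ = μ₂`. [cite: EminentiLanaveMantegazza2008, §3 (p. 7)] -/
theorem IsMetricOn.eigenvalues_at_pinching_minimum_three (hG : IsMetricOn G V) (hx : x ∈ V)
    (hpos : ∀ w : E, w ≠ 0 → 0 < G x w w) (hf : ContDiffOn ℝ ∞ f V)
    (hsol : ∀ y ∈ V, ∀ v w, ricAt G y v w + hessAt G f y v w = lam * G y v w)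
    (e : Basis (Fin 3) ℝ E) (he : ∀ i j, G x (e i) (e j) = if i = j then 1 else 0)
    {μ : Fin 3 → ℝ} (hμ : ∀ i w, ricAt G x (e i) w = μ i * G x (e i) w)
    (hmin : ∀ y ∈ V, ∀ w, m * scalAt G y * G y w w ≤ ricAt G y w w)
    (heq : ricAt G x (e 0) (e 0) = m * scalAt G x * G x (e 0) (e 0))
    (hord₁ : μ 0 ≤ μ 1) (hord₂ : μ 1 ≤ μ 2) (hS : 0 < scalAt G x) :
    (μ 0 = 0 ∧ μ 1 = μ 2) ∨ (μ 0 = μ 1 ∧ μ 1 = μ 2) := by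
  have hi := hG.isInvertible x hx
  have hineq := hG.eigenframe_ineq_at_pinching_minimum hx hpos hf hsol e he hμ hmin heq
  have he00 : G x (e 0) (e 0) = 1 := by rw [he]; simp
  have hμ0 : μ 0 = m * scalAt G x := by
    have h := heq
    rw [hμ, he00] at h
    linarith
  have hSsum : scalAt G x = μ 0 + μ 1 + μ 2 := by
    rw [scalAt_eq_sum_of_eigenframe e he hμ hi, Fin.sum_univ_three]
  -- multiply by `S > 0`: `S Σ' ≤ 2 (mS) |Ric|² = 2 μ₀ |Ric|²`, i.e. ELM's cubic is `≥ 0`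
  have hmul := mul_le_mul_of_nonneg_left hineq hS.le
  have hcubic : 0 ≤ μ 0 ^ 2 * (2 * μ 0 - μ 1 - μ 2) - (μ 1 + μ 2) * (μ 1 - μ 2) ^ 2 := by
    have h2 : scalAt G x * (2 * m * (μ 0 ^ 2 + μ 1 ^ 2 + μ 2 ^ 2)) =
        2 * μ 0 * (μ 0 ^ 2 + μ 1 ^ 2 + μ 2 ^ 2) := by rw [hμ0]; ring
    rw [h2, hSsum] at hmul
    nlinarith [hmul]
  rw [hSsum] at hS
  exact Literature.Geometry.Riemannian.ELM.eigenvalues_of_cubic_three_nonneg hord₁ hord₂ hS hcubic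

end MetricCoord

end Literature.Geometry.Lorentzian

end
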